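import Mathlib
import HarnessLib

/-!
# The window reflection in the Mellin variable: `û(1 − s) = ± û(s)` for even / odd window functions

Helper file (`--supports stmt-RiemannHypothesis-0098`), one substitution, no definitions.  Seat rh-explicit-weil-5 gen14 (file of record
`HOME/rh-explicit-weil-5/WEIL5-CLASS.md` §3, H_MOD4).

Context (documentation only).  The cell's window transform of `u` supported in `[-a, a]` is `û(s) = ∫_{-a}^{a} u(x) e^{(s−½)x} dx`
(`Theorems/WeilTransportMellinDiagonal`: for a transported seed `û(s) = e^{sa} D_M(s) M_S(s) −` far-wall terms).  The parity sectors of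
the compressed Weil form are the `±1` eigenspaces of the reflection `x ↦ −x`; in the Mellin variable the reflection is `s ↦ 1 − s`:

* `windowTransform_reflect`      : `∫_{-a}^{a} u(−x) e^{(s−½)x} dx = ∫_{-a}^{a} u(x) e^{((1−s)−½)x} dx` (substitution `x ↦ −x`);
* `windowTransform_even`         : `u` even ⟹ `û(1 − s) = û(s)`;
* `windowTransform_odd`          : `u` odd  ⟹ `û(1 − s) = −û(s)`.

Combined with the Mellin diagonalisation this reads `M_{RS}(s) = e^{(1−2s)a}·[D_M(1−s)/D_M(s)]·M_S(1−s)` + far-wall terms for the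
reflected seed `RS` — and `D_M(1−s)/D_M(s) ≈ ζ(1−s)/ζ(s) = 1/χ(s)` below height `c` is the Mellin multiplier of the Fourier cosine
transform: the reflection acts on seeds as a scaled finite Fourier transform, whose eigenfunctions are the prolates with eigenvalues
`∝ iⁿ` — hence even `u` ↔ `n ≡ 0 (mod 4)`, odd `u` ↔ `n ≡ 2 (mod 4)` (WEIL5-CLASS §3; this file certifies only the exact reflection step).

Standard axioms only; no `sorry`.
-/

set_option linter.dupNamespace false
set_option autoImplicit false

noncomputable section

open Real intervalIntegral

namespace Summit.RiemannHypothesis.RiemannHypothesis.Theorems.WeilWindowReflection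

/-- The reflection `x ↦ −x` in the window transform is `s ↦ 1 − s` in the Mellin variable:
`∫_{-a}^{a} u(−x) e^{(s−½)x} dx = ∫_{-a}^{a} u(x) e^{((1−s)−½)x} dx`. -/
theorem windowTransform_reflect (u : ℝ → ℂ) (a : ℝ) (s : ℂ) :
    ∫ x in (-a)..a, u (-x) * Complex.exp ((s - 1 / 2) * (x : ℂ))
      = ∫ x in (-a)..a, u x * Complex.exp (((1 - s) - 1 / 2) * (x : ℂ)) := by
  have e : ∀ x : ℝ, u (-x) * Complex.exp ((s - 1 / 2) * (x : ℂ))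
      = (fun y : ℝ => u y * Complex.exp (((1 - s) - 1 / 2) * (y : ℂ))) (-x) := by
    intro x
    simp only [Complex.ofReal_neg]
    rw [show (s - 1 / 2) * (x : ℂ) = ((1 - s) - 1 / 2) * -(x : ℂ) by ring]
  simp_rw [e]
  rw [intervalIntegral.integral_comp_neg (fun y : ℝ => u y * Complex.exp (((1 - s) - 1 / 2) * (y : ℂ))), neg_neg]

/-- EVEN window functions: `û(1 − s) = û(s)`. -/
theorem windowTransform_even (u : ℝ → ℂ) (hu : ∀ x, u (-x) = u x) (a : ℝ) (s : ℂ) :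
    ∫ x in (-a)..a, u x * Complex.exp (((1 - s) - 1 / 2) * (x : ℂ))
      = ∫ x in (-a)..a, u x * Complex.exp ((s - 1 / 2) * (x : ℂ)) := by
  rw [← windowTransform_reflect u a s]
  refine intervalIntegral.integral_congr fun x _ => ?_
  simp only [hu]

/-- ODD window functions: `û(1 − s) = −û(s)`. -/
theorem windowTransform_odd (u : ℝ → ℂ) (hu : ∀ x, u (-x) = -u x) (a : ℝ) (s : ℂ) :
    ∫ x in (-a)..a, u x * Complex.exp (((1 - s) - 1 / 2) * (x : ℂ))
      = -∫ x in (-a)..a, u x * Complex.exp ((s - 1 / 2) * (x : ℂ)) := by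
  rw [← windowTransform_reflect u a s, ← intervalIntegral.integral_neg]
  refine intervalIntegral.integral_congr fun x _ => ?_
  simp only [hu, neg_mul]

end Summit.RiemannHypothesis.RiemannHypothesis.Theorems.WeilWindowReflection

end
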